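import Summits.Ventures.GridStability.Models.SMIBWellEntry
import HarnessLib

/-!
# GridStability/Models/SMIBClearingThreshold — a certified clearing time of the classical SMIB model is a THRESHOLD (first-swing orbit monotonicity)

Cell `gridfusion` (LADDER-GRIDFUSION G1.SMIB / sub-rung G1-cct), seat gridfusion-model-1,
`plan/PARTITION.md` §0 row `Models/`.  THREE COLUMNS: an a-priori kernel theorem about the typed
MODEL (MODELLED column: classical SMIB, MODEL-VALIDITY MV-1; zero-power fault-on stage with the
machine damping in force, `0 ≤ D_f ≤ D`); no benchmark number; nothing about any machine or grid.

WHY (lead R-CCT-THRESH 2026-08-27): the cell's clearing-time rows for «SMIB-K13post-D10» are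
ENDPOINT statements (a named clearing instant `T` is certified).  lit-1's energy-monotonicity
upgrade (`SMIB.clearing_threshold_zeroPowerFault_damped`, p495557) needs the clearing state AT `T`
in the energy well, false at the bracket (`V(x_F(0.117)) ≈ 0.256 > V_cr ≈ 0.165`).  The threshold
structure is nevertheless a theorem of the model by the PHASE-PLANE argument (orbits as graphs
`ω = W(δ)`, `dω/dδ = ω̇/ω` [cite: Kundur1994, §13.1.3]; equal-area setting [cite: SauerPai1998,
§9.6.3 (9.40)–(9.48)]; no printed monotonicity theorem — lit-1 search 2026-08-27 — the proof is
the cell's own).  `clearing_threshold_of_firstSwing`: post-fault record `p` (`M, D, P_e^max > 0`,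
equilibrium angle `δˢ ∈ (0, π/2)`), fault-on motion `δ̇ = ω`, `M ω̇ = P_m − D_f ω` from `(δ₀, 0)` on
`[0, T]`, `δ₀ > 0`, `V_PE(δ₀) < V_cr`; IF some post-fault solution from `x_F(T)` has a first swing
that turns inside the window (`ω(s₂) ≤ 0`, `δ < π − δˢ` on `[0, s₂]`) THEN for EVERY `t' ∈ [0, T]`
every post-fault solution from `x_F(t')` keeps `δ ∈ (−π − δˢ, π − δˢ)` and tends to `(δˢ, 0)`
(and one exists).  The `Tendsto`-shaped corollary and the instance are in
`SMIBClearingThresholdK13.lean`.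

PROOF: the post-fault orbit from `x_F(t')` cannot cross the BARRIER = fault-on arc `x_F[t', T]`
(strict field comparison at a contact point: post-fault slope `(P_m − P_e^max sin δ − Dω)/(Mω)` <
fault-on slope `(P_m − D_f ω)/(Mω)` since `P_e^max sin δ + (D − D_f)ω > 0`) followed by the
first-swing arc of the motion from `x_F(T)` (non-crossing = uniqueness, `SMIBOrbit.eq_flow`) —
`OrbitGraph.barrier_induction`; so while moving forward its angle stays below the barrier's turning
angle `δ_m < π − δˢ`; it either turns at an angle in `[δ₀, δ_m]`, where `(δ, 0)` is in the energy
well, or creeps forward for ever below `δ_m` and `lim inf ω = 0` puts it in the well; lit-6's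
`energyWell_subset_regionOfAttraction` (p465446) finishes (`SMIBOrbit.roa_of_wellEntry`).
-/

noncomputable section

open Real Set Filter Topology

namespace Summit.Ventures.GridStability.Models.SMIBOrbit

variable {p : Literature.MathematicalPhysics.PowerSystems.SMIB}

/-- **The clearing time certified by a first-swing return is a THRESHOLD (classical SMIB, zero-power
fault with `0 ≤ D_f ≤ D`).**  See the module docstring for the statement in words and the proof.
Hypotheses: post-fault record `p` with `M, D, P_e^max > 0` and equilibrium angle `δˢ ∈ (0, π/2)`;
fault-on motion `δ_F' = ω_F`, `ω_F' = (P_m − D_f ω_F)/M` on `[0, T]` (`T > 0`) from `ω_F(0) = 0`,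
`δ_F(0) > 0`, `V_PE(δ_F(0)) < V_cr`; a post-fault solution `X₂` from `(δ_F T, ω_F T)` with a turn
`(X₂ s₂).2 ≤ 0`, `s₂ ≥ 0`, inside the window (`(X₂ s).1 < π − δˢ` on `[0, s₂]`).  Conclusion, for every
`t' ∈ [0, T]`: a post-fault solution from `(δ_F t', ω_F t')` exists, and every one keeps
`δ ∈ (−π − δˢ, π − δˢ)` for all `s ≥ 0` and tends to `(δˢ, 0)`.  MODELLED: classical SMIB (MV-1),
zero-power fault. [cite: Kundur1994, §13.1.3 and Example 13.1; SauerPai1998, §9.6.3 (9.48)] -/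
theorem clearing_threshold_of_firstSwing (hM : 0 < p.M) (hD : 0 < p.D) (hPmax : 0 < p.Pmax)
    {δs : ℝ} (heq : p.IsEquilibriumAngle δs) (hδs0 : 0 < δs) (hδs1 : δs < π / 2)
    {Df T : ℝ} (hDf : 0 ≤ Df) (hDfD : Df ≤ p.D) (hT : 0 < T)
    {δF ωF : ℝ → ℝ} (hδ : ∀ t ∈ Icc 0 T, HasDerivWithinAt δF (ωF t) (Icc 0 T) t)
    (hω : ∀ t ∈ Icc 0 T, HasDerivWithinAt ωF ((p.Pm - Df * ωF t) / p.M) (Icc 0 T) t)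
    (hω0 : ωF 0 = 0) (hδ00 : 0 < δF 0)
    (hV0 : p.potentialEnergy δs (δF 0) < p.criticalEnergy δs)
    {X₂ : ℝ → ℝ × ℝ} (hX₂0 : X₂ 0 = (δF T, ωF T))
    (hX₂ : ∀ S : ℝ, ∀ t ∈ Icc 0 S, HasDerivWithinAt X₂ (p.vectorField (X₂ t)) (Icc 0 S) t)
    {s₂ : ℝ} (hs₂ : 0 ≤ s₂) (hturn : (X₂ s₂).2 ≤ 0)
    (hwin₂ : ∀ s ∈ Icc 0 s₂, (X₂ s).1 < π - δs) {t' : ℝ} (ht' : t' ∈ Icc 0 T) :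
    (∃ X : ℝ → ℝ × ℝ, X 0 = (δF t', ωF t') ∧
      ∀ S : ℝ, ∀ t ∈ Icc 0 S, HasDerivWithinAt X (p.vectorField (X t)) (Icc 0 S) t) ∧
    ∀ X : ℝ → ℝ × ℝ, X 0 = (δF t', ωF t') →
      (∀ S : ℝ, ∀ t ∈ Icc 0 S, HasDerivWithinAt X (p.vectorField (X t)) (Icc 0 S) t) →
      (∀ s, 0 ≤ s → (X s).1 ∈ Ioo (-π - δs) (π - δs)) ∧ Tendsto X atTop (𝓝 (δs, 0)) := by
  have hPm : 0 < p.Pm := by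
    have h : p.Pm = p.Pmax * Real.sin δs := heq
    rw [h]
    exact mul_pos hPmax (Real.sin_pos_of_pos_of_lt_pi hδs0 (by linarith [Real.pi_pos]))
  -- reduction to the flow line from the clearing state
  suffices key : (∀ s, 0 ≤ s → (flow p hM (δF t', ωF t') s).1 ∈ Ioo (-π - δs) (π - δs)) ∧
      Tendsto (flow p hM (δF t', ωF t')) atTop (𝓝 (δs, 0)) by
    refine ⟨⟨flow p hM (δF t', ωF t'), flow_zero hM _, flow_isSolution hM _⟩, fun X hX0 hX => ?_⟩
    have hXΨ : ∀ s, 0 ≤ s → X s = flow p hM (δF t', ωF t') s := fun s hs => by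
      rw [← hX0]; exact eq_flow hM hX hs
    refine ⟨fun s hs => by rw [hXΨ s hs]; exact key.1 s hs, key.2.congr' ?_⟩
    filter_upwards [eventually_ge_atTop 0] with s hs
    exact (hXΨ s hs).symm
  -- fault-on facts
  have hcontδ : ContinuousOn δF (Icc 0 T) := fun t ht => (hδ t ht).continuousWithinAt
  have hcontω : ContinuousOn ωF (Icc 0 T) := fun t ht => (hω t ht).continuousWithinAt
  have hmonoF : StrictMonoOn δF (Icc 0 T) := faultOn_angle_strictMonoOn hM hPm hDf hδ hω hω0
  have hωpos : ∀ t ∈ Ioc 0 T, 0 < ωF t := fun t ht => faultOn_speed_pos hM hPm hDf hω hω0 ht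
  have h0T : (0 : ℝ) ∈ Icc 0 T := ⟨le_rfl, hT.le⟩
  have hTT : T ∈ Icc 0 T := ⟨hT.le, le_rfl⟩
  have hδT : δF T < π - δs := by
    have h := hwin₂ 0 ⟨le_rfl, hs₂⟩
    rwa [hX₂0] at h
  have hωT : 0 < ωF T := hωpos T ⟨hT, le_rfl⟩
  have hδt' : δF 0 ≤ δF t' := hmonoF.monotoneOn h0T ht' ht'.1
  have hδt'T : δF t' ≤ δF T := hmonoF.monotoneOn ht' hTT ht'.2
  -- the case t' = 0: the clearing state (δ₀, 0) is in the energy well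
  rcases ht'.1.eq_or_lt with ht'0 | ht'pos
  · rw [← ht'0, hω0]
    refine roa_of_wellEntry hM hD hPmax heq hδs0.le hδs1 le_rfl (fun s hs => ?_) ?_
    · rw [show s = 0 from le_antisymm hs.2 hs.1, flow_zero]
      exact ⟨by linarith [Real.pi_pos], by linarith⟩
    · rw [flow_zero, energy_of_speed_zero]
      exact hV0
  -- the case t' > 0
  have hδt'pos : δF 0 < δF t' := hmonoF h0T ht' ht'pos
  have hωt' : 0 < ωF t' := hωpos t' ⟨ht'pos, ht'.2⟩
  -- traj 2 as a flow line; its first turn and turning angle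
  obtain ⟨Ξ, hΞ⟩ : ∃ Ξ : ℝ → ℝ × ℝ, flow p hM (δF T, ωF T) = Ξ := ⟨_, rfl⟩
  have hX₂Ξ : ∀ s, 0 ≤ s → X₂ s = Ξ s := fun s hs => by
    rw [← hΞ, ← hX₂0]; exact eq_flow hM hX₂ hs
  have hΞ0 : Ξ 0 = (δF T, ωF T) := by rw [← hΞ, flow_zero]
  have hcontΞ : Continuous Ξ := by rw [← hΞ]; exact continuous_flow hM _
  have hcontΞ1 : Continuous fun s => (Ξ s).1 := continuous_fst.comp hcontΞ
  have hcontΞ2 : Continuous fun s => (Ξ s).2 := continuous_snd.comp hcontΞ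
  have hΞ1' : ∀ x, HasDerivAt (fun s => (Ξ s).1) (Ξ x).2 x := fun x => by
    rw [← hΞ]; exact hasDerivAt_flow_fst hM _ x
  have hΞ0pos : 0 < (Ξ 0).2 := by rw [hΞ0]; exact hωT
  have hΞs₂ : (Ξ s₂).2 ≤ 0 := by rw [← hX₂Ξ s₂ hs₂]; exact hturn
  obtain ⟨s₁, hs₁, hs₁₂, hzero, hpos₂⟩ :=
    OrbitGraph.exists_firstZero (ω := fun s => (Ξ s).2) hcontΞ2 hΞ0pos hs₂ hΞs₂
  have hmono₂ : StrictMonoOn (fun s => (Ξ s).1) (Icc 0 s₁) := by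
    refine strictMonoOn_of_deriv_pos (convex_Icc 0 s₁) (f := fun s => (Ξ s).1)
      hcontΞ1.continuousOn fun x hx => ?_
    rw [interior_Icc] at hx
    rw [(hΞ1' x).deriv]
    exact hpos₂ x ⟨hx.1.le, hx.2⟩
  have hδm_gt : δF T < (Ξ s₁).1 := by
    have h : (Ξ 0).1 < (Ξ s₁).1 := hmono₂ ⟨le_rfl, hs₁.le⟩ ⟨hs₁.le, le_rfl⟩ hs₁
    rwa [hΞ0] at h
  have hδm_lt : (Ξ s₁).1 < π - δs := by
    have h := hwin₂ s₁ ⟨hs₁.le, hs₁₂⟩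
    rwa [hX₂Ξ s₁ hs₁.le] at h
  have hδm_pos : 0 < (Ξ s₁).1 := by linarith
  -- the graph of the fault-on arc
  obtain ⟨ψF, hψF⟩ : ∃ ψ : ℝ → ℝ, OrbitGraph.arcInv δF 0 T = ψ := ⟨_, rfl⟩
  have hψF_apply : ∀ t ∈ Icc 0 T, ψF (δF t) = t := fun t ht => by
    rw [← hψF]; exact OrbitGraph.arcInv_apply hT.le hmonoF ht
  have hψF_mem : ∀ y ∈ Icc (δF 0) (δF T), ψF y ∈ Icc 0 T := fun y hy => by
    rw [← hψF]; exact OrbitGraph.arcInv_mem hT.le hcontδ hmonoF hy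
  have hδψF : ∀ y ∈ Icc (δF 0) (δF T), δF (ψF y) = y := fun y hy => by
    rw [← hψF]; exact OrbitGraph.apply_arcInv hT.le hcontδ hmonoF hy
  have hψF_cont : Continuous ψF := by
    rw [← hψF]; exact OrbitGraph.continuous_arcInv hT.le hcontδ hmonoF
  have hψF_mono : StrictMono ψF := by
    rw [← hψF]; exact OrbitGraph.strictMono_arcInv hT.le hcontδ hmonoF
  have hψF' : ∀ y, ψF y ∈ Ioo 0 T → ∀ d, HasDerivAt δF d (ψF y) → d ≠ 0 →
      HasDerivAt ψF d⁻¹ y := by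
    intro y hy d hd hd0
    rw [← hψF] at hy hd ⊢
    exact OrbitGraph.hasDerivAt_arcInv hT.le hcontδ hmonoF hy hd hd0
  obtain ⟨WF, hWF⟩ : ∃ W : ℝ → ℝ, (fun y => ωF (max 0 (min (ψF y) T))) = W := ⟨_, rfl⟩
  have hWF_cont : Continuous WF := by
    rw [← hWF]
    exact hcontω.comp_continuous (continuous_const.max (hψF_cont.min continuous_const))
      (fun y => ⟨le_max_left _ _, max_le hT.le (min_le_right _ _)⟩)
  have hWF_eq : ∀ y ∈ Icc (δF 0) (δF T), WF y = ωF (ψF y) := fun y hy => by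
    rw [← hWF]
    obtain ⟨h1, h2⟩ := hψF_mem y hy
    simp only [min_eq_left h2, max_eq_right h1]
  have hWF_apply : ∀ t ∈ Icc 0 T, WF (δF t) = ωF t := fun t ht => by
    rw [hWF_eq (δF t) ⟨hmonoF.monotoneOn h0T ht ht.1, hmonoF.monotoneOn ht hTT ht.2⟩, hψF_apply t ht]
  -- the graph of the first-swing arc of traj 2
  obtain ⟨ψ2, hψ2⟩ : ∃ ψ : ℝ → ℝ, OrbitGraph.arcInv (fun s => (Ξ s).1) 0 s₁ = ψ := ⟨_, rfl⟩
  have hψ2_mem : ∀ y ∈ Icc ((Ξ 0).1) ((Ξ s₁).1), ψ2 y ∈ Icc 0 s₁ := fun y hy => by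
    rw [← hψ2]; exact OrbitGraph.arcInv_mem hs₁.le hcontΞ1.continuousOn hmono₂ hy
  have hΞψ2 : ∀ y ∈ Icc ((Ξ 0).1) ((Ξ s₁).1), (Ξ (ψ2 y)).1 = y := fun y hy => by
    rw [← hψ2]
    exact OrbitGraph.apply_arcInv (δ := fun s => (Ξ s).1) hs₁.le hcontΞ1.continuousOn hmono₂ hy
  have hψ2_apply : ∀ s ∈ Icc 0 s₁, ψ2 ((Ξ s).1) = s := fun s hs => by
    rw [← hψ2]
    exact OrbitGraph.arcInv_apply (δ := fun s => (Ξ s).1) hs₁.le hmono₂ hs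
  have hψ2_cont : Continuous ψ2 := by
    rw [← hψ2]; exact OrbitGraph.continuous_arcInv hs₁.le hcontΞ1.continuousOn hmono₂
  have hψ2_mono : StrictMono ψ2 := by
    rw [← hψ2]; exact OrbitGraph.strictMono_arcInv hs₁.le hcontΞ1.continuousOn hmono₂
  obtain ⟨W2, hW2⟩ : ∃ W : ℝ → ℝ, (fun y => (Ξ (max 0 (min (ψ2 y) s₁))).2) = W := ⟨_, rfl⟩
  have hW2_cont : Continuous W2 := by
    rw [← hW2]
    exact hcontΞ2.comp (continuous_const.max (hψ2_cont.min continuous_const))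
  have hW2_apply : ∀ s ∈ Icc 0 s₁, W2 ((Ξ s).1) = (Ξ s).2 := fun s hs => by
    rw [← hW2]
    simp only [hψ2_apply s hs, min_eq_left hs.2, max_eq_right hs.1]
  -- the barrier
  obtain ⟨B, hB⟩ : ∃ B : ℝ → ℝ, (fun y => if y ≤ δF T then WF y else W2 y) = B := ⟨_, rfl⟩
  have hB_le : ∀ y, y ≤ δF T → B y = WF y := fun y hy => by rw [← hB]; simp [hy]
  have hB_gt : ∀ y, δF T < y → B y = W2 y := fun y hy => by rw [← hB]; simp [not_le.2 hy]
  have hB_cont : Continuous B := by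
    rw [← hB]
    refine Continuous.if_le hWF_cont hW2_cont continuous_id continuous_const fun y hy => ?_
    rw [hy, hWF_apply T hTT]
    have h := hW2_apply 0 ⟨le_rfl, hs₁.le⟩
    rw [hΞ0] at h
    exact h.symm
  -- traj 1 as a flow line
  obtain ⟨Ψ, hΨ⟩ : ∃ Ψ : ℝ → ℝ × ℝ, flow p hM (δF t', ωF t') = Ψ := ⟨_, rfl⟩
  have hΨ0 : Ψ 0 = (δF t', ωF t') := by rw [← hΨ, flow_zero]
  have hcontΨ : Continuous Ψ := by rw [← hΨ]; exact continuous_flow hM _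
  have hcontΨ1 : Continuous fun s => (Ψ s).1 := continuous_fst.comp hcontΨ
  have hcontΨ2 : Continuous fun s => (Ψ s).2 := continuous_snd.comp hcontΨ
  have hΨ1' : ∀ x, HasDerivAt (fun s => (Ψ s).1) (Ψ x).2 x := fun x => by
    rw [← hΨ]; exact hasDerivAt_flow_fst hM _ x
  have hΨ2' : ∀ x, HasDerivAt (fun s => (Ψ s).2) (p.accel (Ψ x).1 (Ψ x).2) x := fun x => by
    rw [← hΨ]; exact hasDerivAt_flow_snd hM _ x
  have hshift : ∀ x r σ, Ψ x = Ξ σ → Ψ (x + r) = Ξ (σ + r) := by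
    intro x r σ hstate
    rw [← hΞ, flow_add, hΞ, ← hstate, ← hΨ, flow_add]
  -- NO OVERTAKING: while traj 1 moves forward, its angle never reaches the turning angle of traj 2
  have claim : ∀ sb, 0 < sb → (∀ s ∈ Icc 0 sb, 0 < (Ψ s).2) → (Ψ sb).1 ≠ (Ξ s₁).1 := by
    intro sb hsb hposΨ heqm
    have hmono1 : StrictMonoOn (fun s => (Ψ s).1) (Icc 0 sb) := by
      refine strictMonoOn_of_deriv_pos (convex_Icc 0 sb) (f := fun s => (Ψ s).1)
        hcontΨ1.continuousOn fun x hx => ?_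
      rw [interior_Icc] at hx
      rw [(hΨ1' x).deriv]
      exact hposΨ x ⟨hx.1.le, hx.2.le⟩
    have h0 : (Ψ 0).2 ≤ B (Ψ 0).1 := by
      rw [hΨ0, hB_le _ hδt'T, hWF_apply t' ht']
    have hstep : ∀ x ∈ Ico 0 sb, (Ψ x).2 = B (Ψ x).1 →
        ∀ᶠ r in 𝓝[>] x, (Ψ r).2 ≤ B (Ψ r).1 := by
      intro x hx hcontact
      have hy_ge : δF t' ≤ (Ψ x).1 := by
        have h : (Ψ 0).1 ≤ (Ψ x).1 := hmono1.monotoneOn ⟨le_rfl, hsb.le⟩ ⟨hx.1, hx.2.le⟩ hx.1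
        rwa [hΨ0] at h
      have hy_lt : (Ψ x).1 < (Ξ s₁).1 := by
        have h : (Ψ x).1 < (Ψ sb).1 := hmono1 ⟨hx.1, hx.2.le⟩ ⟨hsb.le, le_rfl⟩ hx.2
        rwa [heqm] at h
      have hy_gt0 : δF 0 < (Ψ x).1 := lt_of_lt_of_le hδt'pos hy_ge
      rcases lt_or_ge (Ψ x).1 (δF T) with hyT | hyT
      · -- contact on the fault-on arc: strict field comparison
        have hymem : (Ψ x).1 ∈ Icc (δF 0) (δF T) := ⟨hy_gt0.le, hyT.le⟩
        obtain ⟨σ, hσ⟩ : ∃ σ, ψF (Ψ x).1 = σ := ⟨_, rfl⟩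
        have hσmem : σ ∈ Icc 0 T := by rw [← hσ]; exact hψF_mem _ hymem
        have hδσ : δF σ = (Ψ x).1 := by rw [← hσ]; exact hδψF _ hymem
        have hσpos : 0 < σ := by
          have h := hψF_mono hy_gt0
          rwa [hψF_apply 0 h0T, hσ] at h
        have hσlt : σ < T := by
          have h := hψF_mono hyT
          rwa [hψF_apply T hTT, hσ] at h
        have hωσ : (Ψ x).2 = ωF σ := by rw [hcontact, hB_le _ hyT.le, hWF_eq _ hymem, hσ]
        have hw : 0 < ωF σ := hωpos σ ⟨hσpos, hσmem.2⟩
        have hδ' : HasDerivAt δF (ωF σ) σ := (hδ σ hσmem).hasDerivAt (Icc_mem_nhds hσpos hσlt)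
        have hω' : HasDerivAt ωF ((p.Pm - Df * ωF σ) / p.M) σ :=
          (hω σ hσmem).hasDerivAt (Icc_mem_nhds hσpos hσlt)
        have hψFd : HasDerivAt ψF (ωF σ)⁻¹ (Ψ x).1 := by
          refine hψF' _ ?_ _ ?_ hw.ne'
          · rw [hσ]; exact ⟨hσpos, hσlt⟩
          · rw [hσ]; exact hδ'
        have hWFd : HasDerivAt WF ((p.Pm - Df * ωF σ) / p.M * (ωF σ)⁻¹) (Ψ x).1 := by
          have hcomp : HasDerivAt (fun y => ωF (ψF y)) ((p.Pm - Df * ωF σ) / p.M * (ωF σ)⁻¹)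
              (Ψ x).1 := by
            refine HasDerivAt.comp (Ψ x).1 ?_ hψFd
            rw [hσ]; exact hω'
          refine hcomp.congr_of_eventuallyEq ?_
          filter_upwards [Ioo_mem_nhds hy_gt0 hyT] with y' hy'
          exact hWF_eq y' (Ioo_subset_Icc_self hy')
        have hg : HasDerivAt (fun r => WF ((Ψ r).1) - (Ψ r).2)
            ((p.Pm - Df * ωF σ) / p.M * (ωF σ)⁻¹ * (Ψ x).2 - p.accel (Ψ x).1 (Ψ x).2) x :=
          (hWFd.comp x (hΨ1' x)).sub (hΨ2' x)
        have hgx : (fun r => WF ((Ψ r).1) - (Ψ r).2) x = 0 := by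
          dsimp only
          rw [hcontact, hB_le _ hyT.le, sub_self]
        have hgpos : 0 < (p.Pm - Df * ωF σ) / p.M * (ωF σ)⁻¹ * (Ψ x).2 -
            p.accel (Ψ x).1 (Ψ x).2 := by
          rw [hωσ, ← hδσ, inv_mul_cancel_right₀ hw.ne']
          unfold Literature.MathematicalPhysics.PowerSystems.SMIB.accel
          have hsin : 0 < Real.sin (δF σ) := by
            rw [hδσ]
            exact Real.sin_pos_of_pos_of_lt_pi (hδ00.trans hy_gt0) (by linarith [hδT, hyT])
          have hrew : (p.Pm - Df * ωF σ) / p.M - (p.Pm - p.Pmax * Real.sin (δF σ) - p.D * ωF σ) / p.M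
              = (p.Pmax * Real.sin (δF σ) + (p.D - Df) * ωF σ) / p.M := by
            field_simp
            ring
          rw [hrew]
          exact div_pos (by nlinarith [mul_pos hPmax hsin, mul_nonneg (sub_nonneg.2 hDfD) hw.le]) hM
        have hev := OrbitGraph.eventually_pos_of_hasDerivWithinAt hg.hasDerivWithinAt hgx hgpos
        have hev2 : ∀ᶠ r in 𝓝 x, (Ψ r).1 < δF T :=
          hcontΨ1.continuousAt.eventually_lt continuousAt_const hyT
        filter_upwards [hev, eventually_nhdsWithin_of_eventually_nhds hev2] with r hr1 hr2
        rw [hB_le _ hr2.le]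
        linarith
      · -- contact on the first-swing arc of traj 2: the orbits merge (uniqueness)
        have hymem : (Ψ x).1 ∈ Icc ((Ξ 0).1) ((Ξ s₁).1) := by
          rw [hΞ0]; exact ⟨hyT, hy_lt.le⟩
        obtain ⟨σ, hσ⟩ : ∃ σ, ψ2 (Ψ x).1 = σ := ⟨_, rfl⟩
        have hσmem : σ ∈ Icc 0 s₁ := by rw [← hσ]; exact hψ2_mem _ hymem
        have hΞσ : (Ξ σ).1 = (Ψ x).1 := by rw [← hσ]; exact hΞψ2 _ hymem
        have hσlt : σ < s₁ := by
          have h := hψ2_mono hy_lt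
          rwa [hψ2_apply s₁ ⟨hs₁.le, le_rfl⟩, hσ] at h
        have hBy : B (Ψ x).1 = (Ξ σ).2 := by
          rcases hyT.lt_or_eq with hlt | hyeq
          · rw [hB_gt _ hlt, ← hΞσ, hW2_apply σ hσmem]
          · have hσ0 : σ = 0 := by
              rw [← hσ, ← hyeq, ← hψ2_apply 0 ⟨le_rfl, hs₁.le⟩, hΞ0]
            rw [← hyeq, hB_le _ le_rfl, hWF_apply T hTT, hσ0, hΞ0]
        have hstate : Ψ x = Ξ σ := Prod.ext hΞσ.symm (by rw [hcontact, hBy])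
        have hnhds : Ioo x (x + (s₁ - σ)) ∈ 𝓝[>] x := Ioo_mem_nhdsGT (by linarith)
        filter_upwards [hnhds] with r hr
        have hr' : x + (r - x) = r := by ring
        have hρ0 : 0 < σ + (r - x) := by linarith [hσmem.1, hr.1]
        have hρ1 : σ + (r - x) < s₁ := by linarith [hr.2]
        have hΨr : Ψ r = Ξ (σ + (r - x)) := by
          have h := hshift x (r - x) σ hstate
          rwa [hr'] at h
        have hgt : δF T < (Ξ (σ + (r - x))).1 := by
          have h : (Ξ 0).1 < (Ξ (σ + (r - x))).1 := hmono₂ ⟨le_rfl, hs₁.le⟩ ⟨hρ0.le, hρ1.le⟩ hρ0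
          rwa [hΞ0] at h
        rw [hΨr, hB_gt _ hgt, hW2_apply _ ⟨hρ0.le, hρ1.le⟩]
    have hbar : (Ψ sb).2 ≤ B (Ψ sb).1 :=
      OrbitGraph.barrier_induction (u := fun s => (Ψ s).1) (v := fun s => (Ψ s).2)
        hcontΨ1.continuousOn hcontΨ2.continuousOn hB_cont h0 hstep sb ⟨hsb.le, le_rfl⟩
    rw [heqm, hB_gt _ hδm_gt, hW2_apply s₁ ⟨hs₁.le, le_rfl⟩, hzero] at hbar
    exact absurd hbar (not_le.2 (hposΨ sb ⟨hsb.le, le_rfl⟩))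
  -- consequence: while moving forward, the angle of traj 1 stays below the turning angle
  have hR : ∀ sb, 0 ≤ sb → (∀ s ∈ Icc 0 sb, 0 < (Ψ s).2) → (Ψ sb).1 < (Ξ s₁).1 := by
    intro sb hsb hposΨ
    by_contra hge
    push Not at hge
    have h0v : (Ψ 0).1 < (Ξ s₁).1 := by rw [hΨ0]; exact lt_of_le_of_lt hδt'T hδm_gt
    obtain ⟨c, hc, hcv⟩ :=
      intermediate_value_Icc hsb hcontΨ1.continuousOn ⟨h0v.le, hge⟩
    have hc0 : 0 < c := by
      rcases hc.1.eq_or_lt with h | h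
      · exfalso
        rw [← h] at hcv
        exact absurd hcv h0v.ne
      · exact h
    exact claim c hc0 (fun s hs => hposΨ s ⟨hs.1, hs.2.trans hc.2⟩) hcv
  have hmonoΨ : ∀ sb, (∀ s ∈ Ico 0 sb, 0 < (Ψ s).2) → MonotoneOn (fun s => (Ψ s).1) (Icc 0 sb) := by
    intro sb hposΨ
    refine monotoneOn_of_deriv_nonneg (convex_Icc 0 sb) hcontΨ1.continuousOn
      (fun x _ => (hΨ1' x).differentiableAt.differentiableWithinAt) fun x hx => ?_
    rw [interior_Icc] at hx
    rw [(hΨ1' x).deriv]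
    exact (hposΨ x ⟨hx.1.le, hx.2⟩).le
  -- a time at which traj 1 is in the energy well, with the angle in [δ_F t', δ_m] before
  have hgood : ∃ sg, 0 ≤ sg ∧ (∀ s ∈ Icc 0 sg, (Ψ s).1 ∈ Icc (δF t') ((Ξ s₁).1)) ∧
      p.energy δs (Ψ sg) < p.criticalEnergy δs := by
    by_cases hturn1 : ∃ s, 0 ≤ s ∧ (Ψ s).2 ≤ 0
    · -- traj 1 turns: at its first turn it sits on the δ-axis inside [δ_F t', δ_m]
      obtain ⟨s, hs0, hsle⟩ := hturn1
      have hΨ0pos : 0 < (Ψ 0).2 := by rw [hΨ0]; exact hωt'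
      obtain ⟨sp, hsp, -, hspz, hspp⟩ := OrbitGraph.exists_firstZero hcontΨ2 hΨ0pos hs0 hsle
      have hmono1 := hmonoΨ sp hspp
      have hlt : ∀ s ∈ Ico 0 sp, (Ψ s).1 < (Ξ s₁).1 := fun s hs =>
        hR s hs.1 (fun r hr => hspp r ⟨hr.1, lt_of_le_of_lt hr.2 hs.2⟩)
      have hle : (Ψ sp).1 ≤ (Ξ s₁).1 := le_of_lt_on_Ico hcontΨ1 hsp hlt
      refine ⟨sp, hsp.le, fun r hr => ⟨?_, ?_⟩, ?_⟩
      · have h : (Ψ 0).1 ≤ (Ψ r).1 := hmono1 ⟨le_rfl, hsp.le⟩ hr hr.1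
        rwa [hΨ0] at h
      · rcases hr.2.lt_or_eq with h | h
        · exact (hlt r ⟨hr.1, h⟩).le
        · rw [h]; exact hle
      · have hpt : Ψ sp = ((Ψ sp).1, 0) := Prod.ext rfl hspz
        rw [hpt, energy_of_speed_zero]
        have hlo : δF t' ≤ (Ψ sp).1 := by
          have h : (Ψ 0).1 ≤ (Ψ sp).1 := hmono1 ⟨le_rfl, hsp.le⟩ ⟨hsp.le, le_rfl⟩ hsp.le
          rwa [hΨ0] at h
        exact potentialEnergy_lt_criticalEnergy hPmax heq hδs0.le hδs1.le hδ00.le hV0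
          (hδt'.trans hlo) (lt_of_le_of_lt hle hδm_lt)
    · -- traj 1 creeps forward for ever below δ_m: lim inf ω = 0 puts it in the well
      push Not at hturn1
      have hlt : ∀ s, 0 ≤ s → (Ψ s).1 < (Ξ s₁).1 := fun s hs =>
        hR s hs (fun r hr => hturn1 r hr.1)
      have hlo : ∀ s, 0 ≤ s → δF t' ≤ (Ψ s).1 := fun s hs => by
        have h : (Ψ 0).1 ≤ (Ψ s).1 :=
          hmonoΨ s (fun r hr => hturn1 r hr.1) ⟨le_rfl, hs⟩ ⟨hs, le_rfl⟩ hs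
        rwa [hΨ0] at h
      set m : ℝ := max (p.potentialEnergy δs (δF 0)) (p.potentialEnergy δs (Ξ s₁).1) with hm
      have hmcr : m < p.criticalEnergy δs :=
        max_lt hV0 (potentialEnergy_lt_criticalEnergy hPmax heq hδs0.le hδs1.le hδ00.le hV0
          (hδt'.trans (hδt'T.trans hδm_gt.le)) hδm_lt)
      obtain ⟨ε, hε, hε1, hεM⟩ : ∃ ε : ℝ, 0 < ε ∧ ε ≤ 1 ∧ ε ≤ (p.criticalEnergy δs - m) / p.M :=
        ⟨min 1 ((p.criticalEnergy δs - m) / p.M),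
          lt_min one_pos (div_pos (sub_pos.2 hmcr) hM), min_le_left _ _, min_le_right _ _⟩
      obtain ⟨s, hs0, hsε⟩ : ∃ s, 0 ≤ s ∧ (Ψ s).2 < ε := exists_speed_lt hΨ1' hε hlt
      refine ⟨s, hs0, fun r hr => ⟨hlo r hr.1, (hlt r hr.1).le⟩, ?_⟩
      have hωs : 0 < (Ψ s).2 := hturn1 s hs0
      have hPE : p.potentialEnergy δs (Ψ s).1 ≤ m :=
        potentialEnergy_le_max hPmax heq hδs0.le hδs1.le hδ00.le hδm_lt.le
          ⟨hδt'.trans (hlo s hs0), (hlt s hs0).le⟩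
      have hkin : 1 / 2 * p.M * (Ψ s).2 ^ 2 ≤ 1 / 2 * (p.criticalEnergy δs - m) := by
        have hsq : (Ψ s).2 ^ 2 ≤ ε := by nlinarith
        have : p.M * ε ≤ p.criticalEnergy δs - m := by
          rw [le_div_iff₀ hM] at hεM; linarith
        nlinarith
      show 1 / 2 * p.M * (Ψ s).2 ^ 2 + p.potentialEnergy δs (Ψ s).1 < p.criticalEnergy δs
      linarith
  -- finish with lit-6's energy-well theorem on the tail
  obtain ⟨sg, hsg, hwin, hV⟩ := hgood
  refine roa_of_wellEntry hM hD hPmax heq hδs0.le hδs1 hsg (fun s hs => ?_) (by rw [hΨ]; exact hV)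
  rw [hΨ]
  obtain ⟨h1, h2⟩ := hwin s hs
  exact ⟨by linarith [Real.pi_pos], lt_of_le_of_lt h2 hδm_lt⟩

end Summit.Ventures.GridStability.Models.SMIBOrbit

end
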